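import Summits.AtomisticToContinuum.Crystallization.Theorems.ReggeStarCoercivityDefectFreeCrystallizesPalmDefs
import Summits.AtomisticToContinuum.Crystallization.Theorems.PalmUnimodularRigidityShellsToBarlowChartCharts
import Summits.AtomisticToContinuum.Crystallization.Theorems.PalmUnimodularRigidityShellsToBarlowChartLocalCharts
import Literature.Geometry.DiscreteGeometry.KissingPatterns

/-!
# Integer charts at tolerance `a/20` (stub R1a1 `stub_goodCharts` of line `palm-good-law`, crux stmt-AtomisticToContinuum-13603)

Stub `stub_goodCharts` of the lead-c4 skeleton `Cruxes/DefectFreeCrystallizes/Lines/palm_good_law.lean` (v15):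
if every point of `S ⊆ ℝ³` is `SetGood` in `S` (`Theorems.PalmGoodLaw.SetGood`: for some scale `a ∈ [9/10, 11/10]`
the other points of `S` in the OPEN ball of radius `6/5` about `x`, recentred and rescaled by `a⁻¹`, are
`1/20`-matched after a linear isometry `A` to the FCC or the HCP kissing pattern), then at every `x ∈ S` there are
chart data: an integer pattern `Pc x ∈ {fcc3Int, hcpInt}` (both in `ℤ³` at squared norm `18`), the scale
`ac x = a`, the isometry `Ac x = A`, and a labelling `nb x` mapping `Pc x` bijectively onto the bonded neighbours
of `x` (points of `S` at distance in `(0, 6/5)`), each label `t` within `ac x / 20` of its ideal position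
`x + (ac x/√18)·(Ac x) t`, and two BONDED labelled neighbours carry labels at squared distance `18`.

Template: crux 9227's `LocalCharts.localChart_of_shellCloseTo` and `Charts.isZChart_of_localChart` (the `1 %`
version of the same construction).

Proof.  Unpack `SetGood S x`: scale `a`, the finite rescaled recentred shell `T = a⁻¹ • (shell − x)`, an isometry
`A` and a matching `e : T ≃ A(P)` moving each point by `≤ 1/20`, `P = scaledPattern fcc3Int 18`
(`fccKissingPattern_eq_scaledPattern_fcc3Int`) or `scaledPattern hcpInt 18` (`rfl`).  Label `t ∈ fcc3Int / hcpInt`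
↦ pattern point `p_t = (√18)⁻¹ • t` ↦ `A p_t` ↦ the `T`-point `w_t = e⁻¹ (A p_t)` ↦ the shell point
`x + a • w_t ∈ S` (`chart_of_shellCloseTo`).  Bijectivity is bookkeeping (`e` is a bijection, `t ↦ p_t` and `A`
are injective, `a ≠ 0`); closeness is `dist (a • w_t) (a • A p_t) = a · dist w_t (A p_t) ≤ a/20`; bond ⇒ contact:
two labels NOT in contact have pattern distance `≥ √2` (`dist_eq_one_or_sqrt_two_le_of_mem_fcc/hcpKissingPattern`),
so the two shell points are at distance `≥ a (√2 − 1/10) ≥ (9/10)(13/10) = 1.17`, whereas a bonded pair at a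
`SetGood` point is radially pinned at distance `≤ (11/10)(21/20) = 231/200 = 1.155` (`dist_le_of_setGood`, the
upper companion of `JunkStrippingEnergy.le_dist_of_setGood`).
-/

noncomputable section

namespace Summit.AtomisticToContinuum.Crystallization.Theorems.PalmGoodLaw.GoodCharts

open Literature.Geometry.DiscreteGeometry Literature.MathematicalPhysics.StatisticalMechanics
open Summit.AtomisticToContinuum.Crystallization.Theorems.PalmUnimodularRigidityShellsToBarlowChart
  (fcc3Int fccKissingPattern_eq_scaledPattern_fcc3Int hcpKissingPattern_eq_scaledPattern_hcpInt
   scale18_injective dist_scale18_eq_one_iff dist_eq_one_or_sqrt_two_le_of_mem_fccKissingPattern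
   dist_eq_one_or_sqrt_two_le_of_mem_hcpKissingPattern)

/-! ## Upper radial pinning at a `SetGood` point -/

/-- **Upper radial pinning at a `SetGood` point.**  A point of `S` in the open ball of radius `6/5` about a
`SetGood` point `y` of `S` is at distance `≤ 231/200 = (11/10)·(21/20)` from `y`: its rescaled image is
`1/20`-close to a unit vector of the (rotated) pattern, and the scale is `≤ 11/10`. [folklore] -/
theorem dist_le_of_setGood {S : Set (EuclideanSpace ℝ (Fin 3))} {y z : EuclideanSpace ℝ (Fin 3)}
    (h : SetGood S y) (hz : z ∈ S) (hne : z ≠ y) (hlt : dist z y < 6 / 5) :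
    dist z y ≤ 231 / 200 := by
  obtain ⟨a, ha9, ha11, T, hT, hclose⟩ := h
  obtain ⟨P, hP1, A, e, he⟩ : ∃ P : Finset (EuclideanSpace ℝ (Fin 3)), (∀ v ∈ P, ‖v‖ = 1) ∧
      ∃ A : EuclideanSpace ℝ (Fin 3) →ₗᵢ[ℝ] EuclideanSpace ℝ (Fin 3), ∃ e : ↥T ≃ ↥(P.image A),
        ∀ t : ↥T, dist (t : EuclideanSpace ℝ (Fin 3)) (e t) ≤ 1 / 20 := by
    rcases hclose with ⟨A, e, he⟩ | ⟨A, e, he⟩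
    · exact ⟨fccKissingPattern, fun v hv => norm_eq_one_of_mem_fccKissingPattern hv, A, e, he⟩
    · exact ⟨hcpKissingPattern, fun v hv => norm_eq_one_of_mem_hcpKissingPattern hv, A, e, he⟩
  have ha0 : 0 < a := by linarith
  have ht : a⁻¹ • (z - y) ∈ T := by
    rw [← Finset.mem_coe, hT]
    exact ⟨z, ⟨hz, hne, hlt⟩, rfl⟩
  obtain ⟨p, hp, hpq⟩ := Finset.mem_image.1 (e ⟨_, ht⟩).2
  have hqn : ‖(e ⟨_, ht⟩ : EuclideanSpace ℝ (Fin 3))‖ = 1 := by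
    rw [← hpq, A.norm_map, hP1 p hp]
  have h1 : |‖a⁻¹ • (z - y)‖ - ‖(e ⟨_, ht⟩ : EuclideanSpace ℝ (Fin 3))‖| ≤ 1 / 20 :=
    (abs_norm_sub_norm_le _ _).trans (by simpa [dist_eq_norm] using he ⟨_, ht⟩)
  rw [hqn, norm_smul, norm_inv, Real.norm_of_nonneg ha0.le, abs_le] at h1
  have h3 : a * (a⁻¹ * ‖z - y‖) ≤ a * (21 / 20) :=
    mul_le_mul_of_nonneg_left (by linarith [h1.2]) ha0.le
  rw [← mul_assoc, mul_inv_cancel₀ ha0.ne', one_mul] at h3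
  rw [dist_eq_norm]
  linarith

/-! ## The chart from one matched shell -/

/-- **Integer chart from a `1/20`-matched shell** (uniform in the pattern).  If the rescaled recentred open
`6/5`-shell `T` of `x` in an everywhere-`SetGood` set `S` (scale `a ≥ 9/10`) is `1/20`-matched to `A(Pr)` for
the real pattern `Pr = scaledPattern P 18` of an integer pattern `P`, with the pattern distance dichotomy
`dist p q = 1 ∨ √2 ≤ dist p q` on `Pr`, then the matching labels the bonded neighbours of `x` bijectively by
`P`, each label `t` sits within `a/20` of `x + (a/√18) A t`, and two bonded labelled neighbours have labels at
squared distance `18`. [folklore] -/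
theorem chart_of_shellCloseTo {S : Set (EuclideanSpace ℝ (Fin 3))} (hS : ∀ y ∈ S, SetGood S y)
    {x : EuclideanSpace ℝ (Fin 3)} {a : ℝ} (ha9 : 9 / 10 ≤ a) {P : Finset (Fin 3 → ℤ)}
    {Pr : Finset (EuclideanSpace ℝ (Fin 3))} (hPr : Pr = scaledPattern P 18)
    (hP2 : ∀ p ∈ Pr, ∀ q ∈ Pr, p ≠ q → dist p q = 1 ∨ Real.sqrt 2 ≤ dist p q)
    {T : Finset (EuclideanSpace ℝ (Fin 3))}
    (hT : (↑T : Set (EuclideanSpace ℝ (Fin 3))) =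
      (fun z : EuclideanSpace ℝ (Fin 3) => a⁻¹ • (z - x)) ''
        {z : EuclideanSpace ℝ (Fin 3) | z ∈ S ∧ z ≠ x ∧ dist z x < 6 / 5})
    (hclose : ShellCloseTo (1 / 20) T Pr) :
    ∃ (A : EuclideanSpace ℝ (Fin 3) →ₗᵢ[ℝ] EuclideanSpace ℝ (Fin 3))
      (nbr : (Fin 3 → ℤ) → EuclideanSpace ℝ (Fin 3)),
      Set.BijOn nbr (↑P : Set (Fin 3 → ℤ)) {y | y ∈ S ∧ (0 < dist x y ∧ dist x y < 6 / 5)} ∧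
      (∀ t ∈ P, dist (nbr t) (x + (a * (Real.sqrt 18)⁻¹) • A (intVec t)) ≤ a / 20) ∧
      (∀ t ∈ P, ∀ t' ∈ P,
        (0 < dist (nbr t) (nbr t') ∧ dist (nbr t) (nbr t') < 6 / 5) → sqNormInt (t - t') = 18) := by
  classical
  subst hPr
  obtain ⟨A, e₀, he₀⟩ := hclose
  have ha0 : 0 < a := by linarith
  -- the real pattern point `t/√18` of a label `t`
  have hmemP : ∀ t ∈ P,
      ((Real.sqrt 18)⁻¹ • intVec t : EuclideanSpace ℝ (Fin 3)) ∈ scaledPattern P 18 := fun t ht => by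
    rw [scaledPattern]
    exact Finset.mem_image_of_mem _ ht
  have hmem : ∀ t ∈ P, A ((Real.sqrt 18)⁻¹ • intVec t) ∈ (scaledPattern P 18).image A :=
    fun t ht => Finset.mem_image_of_mem _ (hmemP t ht)
  -- the rescaled shell point labelled by `t ∈ P` (junk `0` off `P`)
  obtain ⟨w, hw⟩ : ∃ w : (Fin 3 → ℤ) → EuclideanSpace ℝ (Fin 3), ∀ t (ht : t ∈ P),
      w t = ((e₀.symm ⟨A ((Real.sqrt 18)⁻¹ • intVec t), hmem t ht⟩ : ↥T) : EuclideanSpace ℝ (Fin 3)) :=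
    ⟨fun t => if ht : t ∈ P then
        ((e₀.symm ⟨A ((Real.sqrt 18)⁻¹ • intVec t), hmem t ht⟩ : ↥T) : EuclideanSpace ℝ (Fin 3))
      else 0, fun t ht => dif_pos ht⟩
  -- (1) `x + a • w t` is a shell point of `x`
  have hwS : ∀ t ∈ P, x + a • w t ∈ S ∧ x + a • w t ≠ x ∧ dist (x + a • w t) x < 6 / 5 := by
    intro t ht
    have h : w t ∈ (↑T : Set (EuclideanSpace ℝ (Fin 3))) := by
      rw [hw t ht]
      exact Finset.mem_coe.2 (Finset.coe_mem _)
    rw [hT] at h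
    obtain ⟨z, hz, hzw⟩ := h
    have hzw' : a⁻¹ • (z - x) = w t := hzw
    have hz' : x + a • w t = z := by
      rw [← hzw', smul_smul, mul_inv_cancel₀ ha0.ne', one_smul, add_sub_cancel]
    rw [hz']
    exact hz
  -- (2) it is `1/20`-close to the rotated pattern point
  have hwd : ∀ t (ht : t ∈ P), dist (w t) (A ((Real.sqrt 18)⁻¹ • intVec t)) ≤ 1 / 20 := by
    intro t ht
    have h := he₀ (e₀.symm ⟨A ((Real.sqrt 18)⁻¹ • intVec t), hmem t ht⟩)
    rw [Equiv.apply_symm_apply] at h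
    rw [hw t ht]
    exact h
  -- the chart `nbr t := x + a • w t`
  refine ⟨A, fun t => x + a • w t, ⟨?_, ?_, ?_⟩, ?_, ?_⟩
  · -- into the bonded neighbours
    intro t ht
    obtain ⟨hS', hne, hlt⟩ := hwS t (Finset.mem_coe.1 ht)
    show x + a • w t ∈ S ∧ 0 < dist x (x + a • w t) ∧ dist x (x + a • w t) < 6 / 5
    rw [dist_comm]
    exact ⟨hS', dist_pos.2 hne, hlt⟩
  · -- injective on `P`: `e₀.symm`, `A`, `t ↦ t/√18` and `a • ·` are injective
    intro t ht t' ht' htt'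
    have ht0 : t ∈ P := Finset.mem_coe.1 ht
    have ht0' : t' ∈ P := Finset.mem_coe.1 ht'
    have h1 : a • w t = a • w t' := add_left_cancel htt'
    have h2 : w t = w t' := smul_right_injective (EuclideanSpace ℝ (Fin 3)) ha0.ne' h1
    rw [hw t ht0, hw t' ht0'] at h2
    have h3 := e₀.symm.injective (Subtype.ext h2)
    have h4 : A ((Real.sqrt 18)⁻¹ • intVec t) = A ((Real.sqrt 18)⁻¹ • intVec t') :=
      congrArg Subtype.val h3
    exact scale18_injective (A.injective h4)
  · -- onto the bonded neighbours
    intro y hy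
    obtain ⟨hyS, hpos, hlt⟩ := hy
    have hyx : y ≠ x := by
      intro h
      rw [h, dist_self] at hpos
      exact lt_irrefl _ hpos
    have hyT : a⁻¹ • (y - x) ∈ (↑T : Set (EuclideanSpace ℝ (Fin 3))) := by
      rw [hT]
      exact ⟨y, ⟨hyS, hyx, by rwa [dist_comm]⟩, rfl⟩
    have hyT' : a⁻¹ • (y - x) ∈ T := Finset.mem_coe.1 hyT
    obtain ⟨u, hu, hut⟩ := Finset.mem_image.1 (e₀ ⟨_, hyT'⟩).2
    obtain ⟨t, ht, rfl⟩ := Finset.mem_image.1 hu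
    refine ⟨t, Finset.mem_coe.2 ht, ?_⟩
    have h4 : (⟨A ((Real.sqrt 18)⁻¹ • intVec t), hmem t ht⟩ : ↥((scaledPattern P 18).image A)) =
        e₀ ⟨_, hyT'⟩ := Subtype.ext hut
    show x + a • w t = y
    rw [hw t ht, h4, Equiv.symm_apply_apply]
    show x + a • (a⁻¹ • (y - x)) = y
    rw [smul_smul, mul_inv_cancel₀ ha0.ne', one_smul, add_sub_cancel]
  · -- closeness
    intro t ht
    have h := hwd t ht
    rw [LinearIsometry.map_smul] at h
    show dist (x + a • w t) (x + (a * (Real.sqrt 18)⁻¹) • A (intVec t)) ≤ a / 20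
    rw [dist_add_left, ← smul_smul, dist_smul₀, Real.norm_of_nonneg ha0.le]
    have := mul_le_mul_of_nonneg_left h ha0.le
    linarith
  · -- bond ⇒ contact
    intro t ht t' ht' hb
    obtain ⟨hpos, hlt⟩ := hb
    change 0 < dist (x + a • w t) (x + a • w t') at hpos
    change dist (x + a • w t) (x + a • w t') < 6 / 5 at hlt
    have hne : x + a • w t' ≠ x + a • w t := by
      intro h
      rw [h, dist_self] at hpos
      exact lt_irrefl _ hpos
    -- upper radial pinning at the `SetGood` point `x + a • w t`
    have hup : dist (x + a • w t') (x + a • w t) ≤ 231 / 200 :=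
      dist_le_of_setGood (hS _ (hwS t ht).1) (hwS t' ht').1 hne (by rw [dist_comm]; exact hlt)
    rw [dist_comm, dist_add_left, dist_smul₀, Real.norm_of_nonneg ha0.le] at hup
    rw [dist_add_left, dist_smul₀, Real.norm_of_nonneg ha0.le] at hpos
    have htt' : t ≠ t' := by
      rintro rfl
      rw [dist_self, mul_zero] at hpos
      exact lt_irrefl _ hpos
    have hpq : ((Real.sqrt 18)⁻¹ • intVec t : EuclideanSpace ℝ (Fin 3)) ≠
        (Real.sqrt 18)⁻¹ • intVec t' := fun h => htt' (scale18_injective h)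
    rcases hP2 _ (hmemP t ht) _ (hmemP t' ht') hpq with h1 | h2
    · exact (dist_scale18_eq_one_iff t t').1 h1
    · -- labels not in contact: pattern distance `≥ √2 > 7/5`, shell distance `≥ (13/10)·a > 231/200`
      exfalso
      have h75 : (7 / 5 : ℝ) < Real.sqrt 2 := by
        rw [show (7 / 5 : ℝ) = Real.sqrt ((7 / 5) ^ 2) by rw [Real.sqrt_sq]; norm_num]
        exact Real.sqrt_lt_sqrt (by norm_num) (by norm_num)
      have hA : dist (A ((Real.sqrt 18)⁻¹ • intVec t)) (A ((Real.sqrt 18)⁻¹ • intVec t')) =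
          dist ((Real.sqrt 18)⁻¹ • intVec t : EuclideanSpace ℝ (Fin 3))
            ((Real.sqrt 18)⁻¹ • intVec t') := A.dist_map _ _
      have hd1 := hwd t ht
      have hd2 := hwd t' ht'
      have htri := dist_triangle4 (A ((Real.sqrt 18)⁻¹ • intVec t)) (w t) (w t')
        (A ((Real.sqrt 18)⁻¹ • intVec t'))
      rw [dist_comm (A ((Real.sqrt 18)⁻¹ • intVec t)) (w t)] at htri
      have hlow : 13 / 10 ≤ dist (w t) (w t') := by linarith
      have := mul_le_mul_of_nonneg_left hlow ha0.le
      linarith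

/-! ## The stub -/

/-- **R1a1 `stub_goodCharts` of line `palm-good-law`: integer charts at tolerance `a/20`.**  If every point of
`S` is `SetGood`, there are chart data `ac, Pc, Ac, nb` such that at every `x ∈ S`: the pattern `Pc x` is
`fcc3Int` or `hcpInt`, the scale `ac x ∈ [9/10, 11/10]`, the labelling `nb x` maps `Pc x` bijectively onto the
bonded neighbours of `x` (points of `S` at distance in `(0, 6/5)`), each label `t` lands within `ac x / 20` of
its ideal position `x + (ac x/√18)·(Ac x) t`, and two BONDED labelled neighbours have labels at squared distance
`18`. [folklore] -/
theorem stub_goodCharts :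
    ∀ S : Set (EuclideanSpace ℝ (Fin 3)), (∀ x ∈ S, SetGood S x) →
      ∃ (ac : EuclideanSpace ℝ (Fin 3) → ℝ) (Pc : EuclideanSpace ℝ (Fin 3) → Finset (Fin 3 → ℤ))
        (Ac : EuclideanSpace ℝ (Fin 3) → (EuclideanSpace ℝ (Fin 3) →ₗᵢ[ℝ] EuclideanSpace ℝ (Fin 3)))
        (nb : EuclideanSpace ℝ (Fin 3) → (Fin 3 → ℤ) → EuclideanSpace ℝ (Fin 3)),
        ∀ x ∈ S, (Pc x = fcc3Int ∨ Pc x = hcpInt) ∧ 9 / 10 ≤ ac x ∧ ac x ≤ 11 / 10 ∧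
          Set.BijOn (nb x) (↑(Pc x) : Set (Fin 3 → ℤ))
            {y | y ∈ S ∧ (0 < dist x y ∧ dist x y < 6 / 5)} ∧
          (∀ t ∈ Pc x, dist (nb x t) (x + (ac x * (Real.sqrt 18)⁻¹) • Ac x (intVec t)) ≤ ac x / 20) ∧
          (∀ t ∈ Pc x, ∀ t' ∈ Pc x,
            (0 < dist (nb x t) (nb x t') ∧ dist (nb x t) (nb x t') < 6 / 5) → sqNormInt (t - t') = 18) := by
  intro S hS
  -- chart data at every point of space (junk off `S`), then `choose`
  have key : ∀ x : EuclideanSpace ℝ (Fin 3), ∃ (a : ℝ) (P : Finset (Fin 3 → ℤ))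
      (A : EuclideanSpace ℝ (Fin 3) →ₗᵢ[ℝ] EuclideanSpace ℝ (Fin 3))
      (nbr : (Fin 3 → ℤ) → EuclideanSpace ℝ (Fin 3)), x ∈ S →
      (P = fcc3Int ∨ P = hcpInt) ∧ 9 / 10 ≤ a ∧ a ≤ 11 / 10 ∧
        Set.BijOn nbr (↑P : Set (Fin 3 → ℤ)) {y | y ∈ S ∧ (0 < dist x y ∧ dist x y < 6 / 5)} ∧
        (∀ t ∈ P, dist (nbr t) (x + (a * (Real.sqrt 18)⁻¹) • A (intVec t)) ≤ a / 20) ∧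
        (∀ t ∈ P, ∀ t' ∈ P,
          (0 < dist (nbr t) (nbr t') ∧ dist (nbr t) (nbr t') < 6 / 5) → sqNormInt (t - t') = 18) := by
    intro x
    by_cases hx : x ∈ S
    · obtain ⟨a, ha9, ha11, T, hT, hclose⟩ := hS x hx
      rcases hclose with h | h
      · obtain ⟨A, nbr, hbij, hd, hl⟩ := chart_of_shellCloseTo hS ha9
          fccKissingPattern_eq_scaledPattern_fcc3Int
          (fun p hp q hq hpq => dist_eq_one_or_sqrt_two_le_of_mem_fccKissingPattern hp hq hpq) hT h
        exact ⟨a, fcc3Int, A, nbr, fun _ => ⟨Or.inl rfl, ha9, ha11, hbij, hd, hl⟩⟩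
      · obtain ⟨A, nbr, hbij, hd, hl⟩ := chart_of_shellCloseTo hS ha9
          hcpKissingPattern_eq_scaledPattern_hcpInt
          (fun p hp q hq hpq => dist_eq_one_or_sqrt_two_le_of_mem_hcpKissingPattern hp hq hpq) hT h
        exact ⟨a, hcpInt, A, nbr, fun _ => ⟨Or.inr rfl, ha9, ha11, hbij, hd, hl⟩⟩
    · exact ⟨1, ∅, LinearIsometry.id, fun _ => 0, fun h => (hx h).elim⟩
  choose ac Pc Ac nb hkey using key
  exact ⟨ac, Pc, Ac, nb, hkey⟩

end Summit.AtomisticToContinuum.Crystallization.Theorems.PalmGoodLaw.GoodCharts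

end
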